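import Summits.CriticalPhenomena.PercolationContinuityZ3.Theorems.Transplant.FKConnectivityAllQAntipodalTwoSpinePhiWeight
import Summits.CriticalPhenomena.PercolationContinuityZ3.Theorems.Transplant.FKConnectivityAllQAntipodalTwoSpinePhiRows
import Summits.CriticalPhenomena.PercolationContinuityZ3.Theorems.Transplant.FKConnectivityAllQAntipodalTwoSpineCells
import HarnessLib

/-!
# Connectivity correlation inequalities for `φ_{w,q}` — TWO-SPINE word model: the WHOLE-CELL MOVE `Φ_N` of the rule (R1) at the cell level

Helper file (`--supports stmt-CriticalPhenomena-4575`), FK sub-lane `prim-bschramm-fk-2` (gen 15/16); builds on p205010 (kernel theorem,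
internal audit signed; external expert review pending).  No named facts, no sorries, standard axioms.

Memo `bschramm/FROM-fk-2-g15-TWO-SPINE.md` §11 (R1) / §12 (V1).  `phiN j u v` applies Theorem U's run to each side of type `01` (roots: `y` in the
`γ`-row iff `j`, `z` iff `¬j`).  For a LOSER cell (`cellSign = -1`) whose runs reach no root (non-critical): the image is a WINNER
(`cellSign_phiN`), each side weight — hence the cell exponent, cf. `baseExp_add_two` — is preserved (`sideWeight_phiSide`), and both words
only go up (`phiSide_forall₂`).  Injectivity: `phiRun_injective` (`…TwoSpinePhiInj`).
[cite: Grimmett2006, §3.8 (pp. 61–62); §3.9 (p. 63)]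
-/

noncomputable section

namespace Summit.CriticalPhenomena.PercolationContinuityZ3.Theorems

namespace FK

namespace TwoSpine

open X2Word

/-! ### The whole-cell move `Φ_N` of the two-spine rule (R1) at the cell level -/

/-- Root type of the `A`-side in cell `j`: `y` lies in the `γ`-row iff `j = true`. [folklore] -/
def rootA (j : Bool) : Bool × Bool := (j, !j)

/-- Root type of the `B`-side in cell `j`: `z` lies in the `γ`-row iff `j = false`. [folklore] -/
def rootB (j : Bool) : Bool × Bool := (!j, j)

/-- Apply Theorem U's run to a side iff it is of type `01`. [folklore] -/
def phiSide (r : Bool × Bool) (w : List SLetter) : List SLetter := if topComp r w = (false, true) then phiRun r w else w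

/-- **`Φ_N` on a cell**: Theorem U's injection at the series split node — run on each side of type `01` (the Janus is kept; meant for
NON-CRITICAL cells, where no root is reached). [folklore] -/
def phiN (j : Bool) (u v : List SLetter) : List SLetter × List SLetter := (phiSide (rootA j) u, phiSide (rootB j) v)

/-- The cell sign through the composite types of the two sides. [folklore] -/
theorem cellSign_eq_topComp (j : Bool) (u v : List SLetter) :
    cellSign j u v = bR (topComp (rootA j) u).1 * bR (topComp (rootB j) v).1 - bR (topComp (rootA j) u).2 * bR (topComp (rootB j) v).2 := by
  cases j
  · simp [cellSign, rootA, rootB, topComp_absent, topComp_present]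
  · simp [cellSign, rootA, rootB, topComp_present, topComp_absent]

/-- The cell exponent (`baseExp + 2 - δ₁ - δ₂` at the root modes) through the side weights: it is `sideWeight_A + sideWeight_B` (a loser or
winner cell has `δ`'s making this exact; we state the identity `baseExp + 2 = sideWeight_A + sideWeight_B + δ₁ + δ₂`). [folklore] -/
theorem baseExp_add_two (j : Bool) (u v : List SLetter) :
    baseExp (Mode.o, Mode.o, Mode.o, Mode.o) u v + 2 =
      sideWeight (rootA j) u + sideWeight (rootB j) v + cellDelA j u + cellDelB j v := by
  rw [baseExp_root]
  cases j <;> simp [sideWeight, rootA, rootB, cellDelA, cellDelB, rowDel] <;> split_ifs <;> omega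

/-- A side of type `01` that is run (non-critically) becomes `10`; a side left alone keeps its type. [folklore] -/
theorem topComp_phiSide_of01 {r : Bool × Bool} {w : List SLetter} (h : topComp r w = (false, true)) (hn : phiReachesRoot r w = false) :
    topComp r (phiSide r w) = (true, false) := by
  simp [phiSide, h, topComp_phiRun h hn]

/-- A side that is not of type `01` is left alone. [folklore] -/
theorem phiSide_of_ne01 {r : Bool × Bool} {w : List SLetter} (h : topComp r w ≠ (false, true)) : phiSide r w = w := by
  simp [phiSide, h]

/-- Sign `-1` of a cell in terms of the side types: both complements conduct, not both sides conduct. [folklore] -/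
theorem bR_sign_eq_neg_one (a b c d : Bool) :
    bR a * bR b - bR c * bR d = -1 ↔ (c = true ∧ d = true ∧ ¬(a = true ∧ b = true)) := by
  cases a <;> cases b <;> cases c <;> cases d <;> norm_num [bR]

/-- Sign `+1` of a cell in terms of the side types. [folklore] -/
theorem bR_sign_eq_one (a b c d : Bool) :
    bR a * bR b - bR c * bR d = 1 ↔ (a = true ∧ b = true ∧ ¬(c = true ∧ d = true)) := by
  cases a <;> cases b <;> cases c <;> cases d <;> norm_num [bR]

/-- **R1 lands on a winner** (memo §12 V1): for a LOSER cell whose two top-down runs do not reach their roots, `Φ_N` gives a cell of sign `+1`. [folklore] -/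
theorem cellSign_phiN {j : Bool} {u v : List SLetter} (hl : cellSign j u v = -1)
    (hA : phiReachesRoot (rootA j) u = false) (hB : phiReachesRoot (rootB j) v = false) :
    cellSign j (phiN j u v).1 (phiN j u v).2 = 1 := by
  rw [cellSign_eq_topComp] at hl ⊢
  simp only [phiN]
  rcases hta : topComp (rootA j) u with ⟨a1, a2⟩
  rcases htb : topComp (rootB j) v with ⟨b1, b2⟩
  rw [hta, htb, bR_sign_eq_neg_one] at hl
  obtain ⟨ha2, hb2, hnot⟩ := hl
  subst ha2; subst hb2
  rw [bR_sign_eq_one]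
  cases a1 <;> cases b1
  · -- both sides `01`: both are run
    rw [topComp_phiSide_of01 hta hA, topComp_phiSide_of01 htb hB]; simp
  · -- `A` is `01`, `B` is `11`
    have hB' : topComp (rootB j) v ≠ (false, true) := by rw [htb]; simp
    rw [topComp_phiSide_of01 hta hA, phiSide_of_ne01 hB', htb]; simp
  · -- `A` is `11`, `B` is `01`
    have hA' : topComp (rootA j) u ≠ (false, true) := by rw [hta]; simp
    rw [phiSide_of_ne01 hA', hta, topComp_phiSide_of01 htb hB]; simp
  · exact absurd ⟨rfl, rfl⟩ hnot

/-- **R1 preserves the side weights** (hence the cell exponent, memo §12 V1). [folklore] -/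
theorem sideWeight_phiSide {r : Bool × Bool} {w : List SLetter} (hn : phiReachesRoot r w = false) :
    sideWeight r (phiSide r w) = sideWeight r w := by
  unfold phiSide
  split
  · next h => exact sideWeight_phiRun h hn
  · rfl

/-- **R1 raises both words.** [folklore] -/
theorem phiSide_forall₂ (r : Bool × Bool) (w : List SLetter) :
    List.Forall₂ (fun a b : SLetter => b = a ∨ (a.2 = (false, true) ∧ b = (a.1, true, false))) w (phiSide r w) := by
  unfold phiSide
  split
  · exact phiRun_forall₂ r w
  · exact forall₂_lamFlip_refl w

end TwoSpine

end FK

end Summit.CriticalPhenomena.PercolationContinuityZ3.Theorems
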